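import Mathlib
import HarnessLib

/-!
# Crux `IsobarTomography.BlobRiccatiClosure` (stmt-NavierStokesRegularity-11740), line `Sketch`,
# stub S4b `stub_supGronwall` — Grönwall for the spatial supremum

Registered stub S4b of the peak-reduction skeleton (pure real analysis). For a jointly continuous
`f : [a, b) × E³ → ℝ`, `f ≥ 0`, differentiable in time with derivative `f'`, with `|f'|` bounded
and `f(t, x) → 0` as `‖x‖ → ∞` uniformly on every `[a, t₁]`, `t₁ < b`, and such that
`f'(t, x⋆) ≤ g(t) f(t, x⋆)` at every spatial maximum point `x⋆` with `f(t, x⋆) > 0`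
(`g` continuous on `[a, b)`), one has for all `t ∈ [a, b)` and all `x`

  `f(t, x) ≤ (sup_y f(a, y)) · exp (∫ₐᵗ g)`.

This is the honest form of the classical step "`d⁺/dt ‖ω‖²_∞ ≤ 2 α(x⋆) ‖ω‖²_∞`"
(Majda–Bertozzi §5.1; Constantin–Fefferman 1993).

Proof (first-contact / maximum-principle argument, no Dini derivatives needed). Fix `t` and
`ε > 0` and the barrier `B_ε(s) = (M + ε) exp (∫ₐˢ g + ε (s - a))`, `M = sup f(a, ·)`.
The spatial supremum `m(s) = sup_y f(s, y)` is finite (decay + compactness of closed balls) and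
Lipschitz on `[a, t]` (mean value inequality in time from `|f'| ≤ B`), so the contact set
`{s ∈ [a, t] : B_ε(s) ≤ m(s)}` is closed; if it is non-empty its infimum `s₀` satisfies `s₀ > a`
(`m(a) = M < B_ε(a)`), `m < B_ε` on `[a, s₀)` and `m(s₀) ≥ B_ε(s₀) > 0`. The supremum at `s₀` is
attained at some `y₀` (decay + extreme value theorem on a closed ball), so `h(s) = f(s, y₀) - B_ε(s)`
is `< 0` on `[a, s₀)` and `≥ 0` at `s₀`; hence `h(s₀) = 0` and the (left) derivative
`f'(s₀, y₀) - (g(s₀) + ε) B_ε(s₀)` is `≥ 0`, contradicting the peak inequality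
`f'(s₀, y₀) ≤ g(s₀) f(s₀, y₀) = g(s₀) B_ε(s₀)`. Thus `f(t, x) ≤ m(t) < B_ε(t)` for every `ε > 0`,
and `ε → 0` gives the claim.

References: A. J. Majda, A. L. Bertozzi, *Vorticity and Incompressible Flow* (CUP 2002), §5.1;
P. Constantin, C. Fefferman, Indiana Univ. Math. J. 42 (1993) 775–789.
-/

noncomputable section

open Set Function Filter Topology MeasureTheory

-- the summit and its single sub-problem share the name (CONVENTIONS §1), as in every Theorems file
set_option linter.dupNamespace false

namespace Summit.NavierStokesRegularity.NavierStokesRegularity.Theorems.BlobRiccatiClosure.Sketch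

local notation "E³" => EuclideanSpace ℝ (Fin 3)

/-- **Spatial slices: boundedness and attained supremum.** If `φ : E³ → ℝ` is continuous and
`φ ≤ η` outside the ball of radius `R`, then `φ` is bounded above, and if moreover
`η < sup φ` then the supremum is attained (extreme value theorem on the compact closed ball). -/
theorem supGronwall_sliceMax {φ : E³ → ℝ} (hφ : Continuous φ) {R η : ℝ}
    (hdec : ∀ y, R ≤ ‖y‖ → φ y ≤ η) :
    BddAbove (range φ) ∧ (η < ⨆ y, φ y → ∃ y₀, ∀ y, φ y ≤ φ y₀) := by
  obtain ⟨y₀, -, hmax⟩ := (isCompact_closedBall (0 : E³) (max R 0)).exists_isMaxOn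
    ⟨0, Metric.mem_closedBall_self (le_max_right _ _)⟩ hφ.continuousOn
  have key : ∀ y, φ y ≤ max (φ y₀) η := fun y => by
    by_cases hy : y ∈ Metric.closedBall (0 : E³) (max R 0)
    · exact (isMaxOn_iff.1 hmax y hy).trans (le_max_left _ _)
    · rw [Metric.mem_closedBall, dist_zero_right, not_le] at hy
      exact (hdec y ((le_max_left _ _).trans hy.le)).trans (le_max_right _ _)
  refine ⟨⟨max (φ y₀) η, forall_mem_range.2 key⟩, fun hη => ⟨y₀, fun y => ?_⟩⟩
  obtain ⟨y₁, hy₁⟩ := exists_lt_of_lt_ciSup hη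
  have h₁ : η < φ y₀ := by
    rcases lt_max_iff.1 (hy₁.trans_le (key y₁)) with h | h
    · exact h
    · exact absurd h (lt_irrefl _)
  simpa [max_eq_left h₁.le] using key y

/-- **First-contact lemma.** If `h` is differentiable at `s₀ > a` with derivative `h'`,
`h < 0` on `[a, s₀)` and `h(s₀) ≥ 0`, then `h(s₀) = 0` and `h' ≥ 0` (sign of the left
difference quotients). -/
theorem supGronwall_touch {h : ℝ → ℝ} {h' a s₀ : ℝ} (has : a < s₀) (hd : HasDerivAt h h' s₀)
    (hneg : ∀ s ∈ Ico a s₀, h s < 0) (hpos : 0 ≤ h s₀) : h s₀ = 0 ∧ 0 ≤ h' := by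
  have hmem : Ico a s₀ ∈ 𝓝[<] s₀ := Ico_mem_nhdsLT has
  have hc : Tendsto h (𝓝[<] s₀) (𝓝 (h s₀)) := hd.continuousAt.continuousWithinAt
  have h0 : h s₀ ≤ 0 := le_of_tendsto hc (mem_of_superset hmem fun s hs => (hneg s hs).le)
  have heq : h s₀ = 0 := le_antisymm h0 hpos
  refine ⟨heq, ?_⟩
  have hsl : Tendsto (slope h s₀) (𝓝[<] s₀) (𝓝 h') := by
    have h1 : HasDerivWithinAt h h' (Iio s₀) s₀ := hd.hasDerivWithinAt
    rwa [hasDerivWithinAt_iff_tendsto_slope' (show s₀ ∉ Iio s₀ from lt_irrefl s₀)] at h1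
  refine ge_of_tendsto hsl (mem_of_superset hmem fun s hs => ?_)
  show 0 ≤ slope h s₀ s
  rw [slope_def_field]
  exact div_nonneg_of_nonpos (by linarith [hneg s hs]) (by linarith [hs.2])

/-- **Barrier, derivative.** For `g` continuous on `[a, b)` and an interior point `a < s₀ < b`,
the barrier `s ↦ C exp (∫ₐˢ g + ε (s - a))` has derivative `C exp(…) (g s₀ + ε)` at `s₀`
(first fundamental theorem of calculus). -/
theorem supGronwall_barrier_hasDerivAt {g : ℝ → ℝ} {a b s₀ : ℝ} (hg : ContinuousOn g (Ico a b))
    (has : a < s₀) (hsb : s₀ < b) (C ε : ℝ) :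
    HasDerivAt (fun s => C * Real.exp ((∫ u in a..s, g u) + ε * (s - a)))
      (C * (Real.exp ((∫ u in a..s₀, g u) + ε * (s₀ - a)) * (g s₀ + ε))) s₀ := by
  have hI : Ico a b ∈ 𝓝 s₀ := mem_of_superset (Ioo_mem_nhds has hsb) Ioo_subset_Ico_self
  have hGd : HasDerivAt (fun s => ∫ u in a..s, g u) (g s₀) s₀ := by
    refine intervalIntegral.integral_hasDerivAt_right ?_ ?_ (hg.continuousAt hI)
    · refine (hg.mono ?_).intervalIntegrable
      rw [uIcc_of_le has.le]
      exact fun s hs => ⟨hs.1, hs.2.trans_lt hsb⟩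
    · exact (hg.mono Ioo_subset_Ico_self).stronglyMeasurableAtFilter isOpen_Ioo s₀ ⟨has, hsb⟩
  have hlin : HasDerivAt (fun s => (∫ u in a..s, g u) + ε * (s - a)) (g s₀ + ε) s₀ := by
    simpa using hGd.fun_add (((hasDerivAt_id' s₀).sub_const a).const_mul ε)
  exact hlin.exp.const_mul C

/-- **Barrier, continuity.** For `g` continuous on `[a, b)` and `a ≤ t < b`, the barrier
`s ↦ C exp (∫ₐˢ g + ε (s - a))` is continuous on `[a, t]`. -/
theorem supGronwall_barrier_continuousOn {g : ℝ → ℝ} {a b t : ℝ} (hg : ContinuousOn g (Ico a b))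
    (hat : a ≤ t) (htb : t < b) (C ε : ℝ) :
    ContinuousOn (fun s => C * Real.exp ((∫ u in a..s, g u) + ε * (s - a))) (Icc a t) := by
  have hG : ContinuousOn (fun s => ∫ u in a..s, g u) (Icc a t) := by
    have hint : IntegrableOn g (uIcc a t) volume := by
      rw [uIcc_of_le hat]
      exact (hg.mono fun s hs => ⟨hs.1, hs.2.trans_lt htb⟩).integrableOn_Icc
    have h := intervalIntegral.continuousOn_primitive_interval hint
    rwa [uIcc_of_le hat] at h
  exact continuousOn_const.mul
    (hG.add (continuousOn_const.mul (continuousOn_id.sub continuousOn_const))).rexp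

/-- **The spatial supremum is continuous in time.** If every time slice `u ↦ f u y` has
derivative `f' s y` within `[a, t]` with `|f'| ≤ B`, and every `f s` is bounded above, then
`s ↦ sup_y f s y` is `B`-Lipschitz, hence continuous, on `[a, t]` (mean value inequality). -/
theorem supGronwall_sup_continuousOn {a t B : ℝ} {f f' : ℝ → E³ → ℝ} (hat : a ≤ t)
    (hd : ∀ s ∈ Icc a t, ∀ y, HasDerivWithinAt (fun u => f u y) (f' s y) (Icc a t) s)
    (hB : ∀ s ∈ Icc a t, ∀ y, |f' s y| ≤ B) (hbdd : ∀ s ∈ Icc a t, BddAbove (range (f s))) :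
    ContinuousOn (fun s => ⨆ y, f s y) (Icc a t) := by
  have hmv : ∀ s ∈ Icc a t, ∀ σ ∈ Icc a t, ∀ y, f σ y ≤ f s y + B * |σ - s| := by
    intro s hs σ hσ y
    have h := (convex_Icc a t).norm_image_sub_le_of_norm_hasDerivWithin_le
      (f := fun u => f u y) (f' := fun u => f' u y) (fun u hu => hd u hu y)
      (fun u hu => by simpa [Real.norm_eq_abs] using hB u hu y) hs hσ
    rw [Real.norm_eq_abs, Real.norm_eq_abs] at h
    linarith [(abs_le.1 h).2]
  have hone : ∀ s ∈ Icc a t, ∀ σ ∈ Icc a t, (⨆ y, f σ y) ≤ (⨆ y, f s y) + B * |σ - s| :=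
    fun s hs σ hσ => ciSup_le fun y =>
      (hmv s hs σ hσ y).trans (by gcongr; exact le_ciSup (hbdd s hs) y)
  have hB0 : 0 ≤ B := (abs_nonneg _).trans (hB a ⟨le_rfl, hat⟩ 0)
  have hlip : LipschitzOnWith B.toNNReal (fun s => ⨆ y, f s y) (Icc a t) := by
    refine LipschitzOnWith.of_dist_le' fun s hs σ hσ => ?_
    rw [Real.dist_eq, Real.dist_eq, abs_sub_le_iff]
    constructor
    · have h1 := hone σ hσ s hs
      linarith
    · have h2 := hone s hs σ hσ
      rw [abs_sub_comm] at h2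
      linarith
  exact hlip.continuousOn

/-- **S4b, SUP-GRÖNWALL LEMMA (Danskin + Grönwall, first-contact form).** Let `f, f' : [a,b) × E³ → ℝ`
be jointly continuous, `u ↦ f u x` differentiable within `[a, b)` with derivative `f' t x`,
`f ≥ 0`, `|f'|` bounded and `f(t, ·) → 0` at infinity uniformly on every `[a, t₁]` (`t₁ < b`),
`g` continuous on `[a, b)`, and `f' t x ≤ g t · f t x` at every global spatial maximum `x` of
`f t` with `f t x > 0`. Then `f t x ≤ (⨆ y, f a y) · exp (∫ₐᵗ g)` for all `t ∈ [a, b)`, `x : E³`.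
Proof: for `ε > 0` the spatial supremum never reaches the barrier
`(⨆ f a + ε) exp (∫ₐˢ g + ε (s - a))` on `[a, t]` (at a first contact time `s₀ > a` the supremum is
attained at some `y₀`, and the left difference quotients of `s ↦ f s y₀ - barrier s` contradict the
peak inequality); then `ε → 0`. -/
theorem stub_supGronwall :
    ∀ (a b : ℝ) (f f' : ℝ → E³ → ℝ) (g : ℝ → ℝ), a < b →
      ContinuousOn (uncurry f) (Ico a b ×ˢ univ) →
      ContinuousOn (uncurry f') (Ico a b ×ˢ univ) →
      (∀ t ∈ Ico a b, ∀ x : E³, HasDerivWithinAt (fun s => f s x) (f' t x) (Ico a b) t) →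
      (∀ t ∈ Ico a b, ∀ x : E³, 0 ≤ f t x) →
      (∀ t₁ ∈ Ico a b, ∃ B : ℝ, ∀ t ∈ Icc a t₁, ∀ x : E³, |f' t x| ≤ B) →
      (∀ t₁ ∈ Ico a b, ∀ ε : ℝ, 0 < ε → ∃ R : ℝ, ∀ t ∈ Icc a t₁, ∀ x : E³, R ≤ ‖x‖ → f t x ≤ ε) →
      ContinuousOn g (Ico a b) →
      (∀ t ∈ Ico a b, ∀ x : E³, IsMaxOn (f t) univ x → 0 < f t x → f' t x ≤ g t * f t x) →
      ∀ t ∈ Ico a b, ∀ x : E³, f t x ≤ (⨆ y, f a y) * Real.exp (∫ s in a..t, g s) := by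
  intro a b f f' g hab hcont _ hderiv hnonneg hbound hdecay hg hpeak t ht x
  have htb : t < b := ht.2
  have hat : a ≤ t := ht.1
  have haI : a ∈ Ico a b := ⟨le_rfl, hab⟩
  have hIcc : Icc a t ⊆ Ico a b := fun s hs => ⟨hs.1, hs.2.trans_lt htb⟩
  -- spatial slices are continuous
  have hslice : ∀ s ∈ Ico a b, Continuous fun y => f s y := fun s hs =>
    hcont.comp_continuous (f := fun y : E³ => (s, y)) (by fun_prop) fun y => mk_mem_prod hs (mem_univ y)
  -- the spatial supremum is finite on `[a, t]` and nonnegative at `a`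
  obtain ⟨R₁, hR₁⟩ := hdecay t ht 1 one_pos
  have hbdd : ∀ s ∈ Icc a t, BddAbove (range (f s)) := fun s hs =>
    (supGronwall_sliceMax (hslice s (hIcc hs)) (hR₁ s hs)).1
  have hM : 0 ≤ ⨆ y, f a y := Real.iSup_nonneg fun y => hnonneg a haI y
  -- the spatial supremum is continuous on `[a, t]`
  obtain ⟨B, hB⟩ := hbound t ht
  have hmc : ContinuousOn (fun s => ⨆ y, f s y) (Icc a t) :=
    supGronwall_sup_continuousOn hat (fun s hs y => (hderiv s (hIcc hs) y).mono hIcc) hB hbdd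
  -- reduction to the `ε`-barriers
  suffices key : ∀ ε : ℝ, 0 < ε →
      f t x ≤ ((⨆ y, f a y) + ε) * Real.exp ((∫ s in a..t, g s) + ε * (t - a)) by
    have hc : Continuous fun ε : ℝ =>
        ((⨆ y, f a y) + ε) * Real.exp ((∫ s in a..t, g s) + ε * (t - a)) := by fun_prop
    have hlim := hc.tendsto 0
    simp only [add_zero, zero_mul] at hlim
    refine ge_of_tendsto (tendsto_nhdsWithin_of_tendsto_nhds (s := Ioi 0) hlim) ?_
    exact mem_of_superset self_mem_nhdsWithin fun ε hε => key ε hε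
  intro ε hε
  set M : ℝ := ⨆ y, f a y with hM_def
  set Bε : ℝ → ℝ := fun s => (M + ε) * Real.exp ((∫ u in a..s, g u) + ε * (s - a)) with hBε_def
  have hBc : ContinuousOn Bε (Icc a t) := supGronwall_barrier_continuousOn hg hat htb (M + ε) ε
  have hBa : Bε a = M + ε := by simp [hBε_def]
  have hBpos : ∀ s, 0 < Bε s := fun s => by
    simp only [hBε_def]
    positivity
  -- the contact set
  set S : Set ℝ := Icc a t ∩ (fun s => (⨆ y, f s y) - Bε s) ⁻¹' Ici 0 with hS_def
  have hSc : IsClosed S := (hmc.sub hBc).preimage_isClosed_of_isClosed isClosed_Icc isClosed_Ici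
  have hSbdd : BddBelow S := ⟨a, fun s hs => hs.1.1⟩
  have haS : a ∉ S := fun h => by
    have h2 : 0 ≤ (⨆ y, f a y) - Bε a := h.2
    rw [hBa] at h2
    linarith
  by_contra hlt
  push Not at hlt
  have htS : t ∈ S :=
    ⟨⟨hat, le_rfl⟩, sub_nonneg.2 (hlt.le.trans (le_ciSup (hbdd t ⟨hat, le_rfl⟩) x))⟩
  -- the first contact time
  set s₀ : ℝ := sInf S with hs₀_def
  have hs₀S : s₀ ∈ S := hSc.csInf_mem ⟨t, htS⟩ hSbdd
  have hs₀t : s₀ ∈ Icc a t := hs₀S.1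
  have has₀ : a < s₀ := lt_of_le_of_ne hs₀t.1 fun h => haS (by rwa [← h] at hs₀S)
  have hs₀b : s₀ < b := hs₀t.2.trans_lt htb
  have hs₀I : s₀ ∈ Ico a b := ⟨hs₀t.1, hs₀b⟩
  have hbelow : ∀ s ∈ Ico a s₀, (⨆ y, f s y) < Bε s := fun s hs => by
    have hsS : s ∉ S := notMem_of_lt_csInf hs.2 hSbdd
    have hst : s ∈ Icc a t := ⟨hs.1, hs.2.le.trans hs₀t.2⟩
    by_contra hle
    exact hsS ⟨hst, sub_nonneg.2 (not_lt.1 hle)⟩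
  -- positivity and attainment of the supremum at `s₀`
  have hm₀ : Bε s₀ ≤ ⨆ y, f s₀ y := sub_nonneg.1 hs₀S.2
  have hmpos : 0 < ⨆ y, f s₀ y := (hBpos s₀).trans_le hm₀
  obtain ⟨R₂, hR₂⟩ := hdecay t ht ((⨆ y, f s₀ y) / 2) (half_pos hmpos)
  obtain ⟨y₀, hy₀⟩ :=
    (supGronwall_sliceMax (hslice s₀ hs₀I) (hR₂ s₀ hs₀t)).2 (half_lt_self hmpos)
  have hmeq : (⨆ y, f s₀ y) = f s₀ y₀ :=
    le_antisymm (ciSup_le hy₀) (le_ciSup (hbdd s₀ hs₀t) y₀)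
  have hfpos : 0 < f s₀ y₀ := hmeq ▸ hmpos
  have hP : f' s₀ y₀ ≤ g s₀ * f s₀ y₀ := hpeak s₀ hs₀I y₀ (isMaxOn_univ_iff.2 hy₀) hfpos
  -- the touching function `s ↦ f s y₀ - Bε s`
  have hfd : HasDerivAt (fun s => f s y₀) (f' s₀ y₀) s₀ :=
    (hderiv s₀ hs₀I y₀).hasDerivAt (mem_of_superset (Ioo_mem_nhds has₀ hs₀b) Ioo_subset_Ico_self)
  have hBd : HasDerivAt Bε
      ((M + ε) * (Real.exp ((∫ u in a..s₀, g u) + ε * (s₀ - a)) * (g s₀ + ε))) s₀ :=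
    supGronwall_barrier_hasDerivAt hg has₀ hs₀b (M + ε) ε
  obtain ⟨h0, hD⟩ := supGronwall_touch has₀ (hfd.fun_sub hBd)
    (fun s hs => by
      have h1 : f s y₀ ≤ ⨆ y, f s y := le_ciSup (hbdd s ⟨hs.1, hs.2.le.trans hs₀t.2⟩) y₀
      have h2 := hbelow s hs
      show f s y₀ - Bε s < 0
      linarith)
    (by show 0 ≤ f s₀ y₀ - Bε s₀; linarith)
  have h0' : f s₀ y₀ - Bε s₀ = 0 := h0
  have hfe : f s₀ y₀ = Bε s₀ := by linarith
  have hBval : Bε s₀ = (M + ε) * Real.exp ((∫ u in a..s₀, g u) + ε * (s₀ - a)) := rfl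
  have hkey : (M + ε) * (Real.exp ((∫ u in a..s₀, g u) + ε * (s₀ - a)) * (g s₀ + ε))
      = g s₀ * Bε s₀ + ε * Bε s₀ := by
    rw [hBval]; ring
  have hD' : 0 ≤ f' s₀ y₀ - (g s₀ * Bε s₀ + ε * Bε s₀) := by rw [← hkey]; exact hD
  rw [hfe] at hP
  linarith [mul_pos hε (hBpos s₀)]

end Summit.NavierStokesRegularity.NavierStokesRegularity.Theorems.BlobRiccatiClosure.Sketch

end
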